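import Literature.MathematicalPhysics.QuantumLattice.FermiRG.FKTLaddersSupportVanishingMomentum
import Literature.Analysis.Fourier.FourierUniquenessPi

/-!
# Feldman–Knörrer–Trubowitz, *Particle–Hole Ladders*: support vanishing — the pinned-leg and single-leg cases

Theorem companion of the typer file `FKTLaddersSec1.lean` (F7a, frozen; nothing there is edited) for
the cell `gate-hubbard-kl` (seat hubbard-kl-t11, gen 2, 2026-08-26/27), continuing the SUPPORT step of
the proof of Lemma II.16 (`\lemLADresectornorm`; tree: the named fact
`FKTLadders.ResectorizationNormBound`, licence F-075 — NOT discharged here) of J. Feldman, H. Knörrer,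
E. Trubowitz, *Particle–Hole Ladders*, Commun. Math. Phys. **247** (2004) 179–194,
arXiv:math-ph/0209044 [FeldmanKnorrerTrubowitz2004Ladders].  Locators `p.N Ln` = chunk `pNNNN.txt`
line `n` of the materialised arXiv TeX, as in F7a.

THE PRINTED STEP (p.13 L48–53): "for any fixed `s₁,…,s₄`, there are at most `3⁴` choices of
`(s'₁,…,s'₄)` for which the integral `∫ ∏_ν (dx'_ν χ̂_{s_ν}((-1)^{b_ν}(x_ν-x'_ν))) f((x'₁,s'₁),…)` fails to
vanish identically, because `f` is sectorized."  Write `P = {μ : i_μ = 1}` for the position legs of a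
leg-kind component `i`, `chg ⊆ P` for the position legs whose side changes scale (these are convolved
with `χ̂`, Definition I.18), `ν ∈ chg` for a leg whose new and old extended sectors are disjoint.  The
siblings `FKTLaddersSupportVanishing` (F7j) and `FKTLaddersSupportVanishingMomentum` (F7m, t10) prove
the vanishing of the `s'`-summand for every component with `chg = P` and `|P| ≥ 2` (F7m's
`integral_resect_eq_zero_of_extSector_disjoint_gen`; re-pinning with momentum legs,
`pinFT_eq_pinFT_of_isTranslationInvariant`, `pinFT_eq_zero_of_not_mem_extSector'` — used here by
name).  THIS FILE adds:

* §3 the KEY LEMMA `integral_prod_chiHat_pinned_eq_zero`: the `χ̂`-convolution, over any set of legs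
  `Q ≃ P ∖ {π}`, of the section of `f|_i(·; s')` PINNED at a position leg `π ≠ ν` vanishes identically
  (F7j's Fubini computation `integral_prod_chiHat_mul_eq_zero` + sectorization at the pin `π` via F7m's
  re-pinning + the momentum completion `surface_update_conserved`); the re-indexing `Q ≃ P ∖ {π}` is transported
  along `MeasurableEquiv.piCongrLeft` (§2), so that one statement serves every caller;
* §4 the case `|P ∖ chg| = 1` — exactly one position leg `π` keeps its scale (the ONE-SIDED patterns
  `ℓ' < ℓ, r' = r` / `ℓ' = ℓ, r' < r` of Lemma II.16 with one position leg on the fixed side):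
  `integral_resect_eq_zero_of_disjoint_pinFree`, pointwise in `y` — translate by `y_π` (Definition I.4
  (ii), the momentum legs contribute a constant phase) and apply the key lemma to the section pinned at
  `π`;
* §4 the case `|P| = 1` WITHOUT Fourier inversion: a sectorized, translation invariant function with a
  single position leg `ν` vanishes at every argument whose CONSERVED momentum of leg `ν` (determined by
  the three momentum legs) lies outside the old extended sector
  (`apply_eq_zero_of_not_mem_extSector_single`; the total Fourier transform of Definition I.5 (ii)
  has no integration variable there), hence so does the `s'`-summand of its resectorisation, whatever
  the new labels (`resectTerm_eq_zero_of_not_mem_extSector_single`) — the surviving old labels are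
  the `≤ 2` sectors containing that momentum (`card_filter_mem_extSector_le_two`, F7i), a
  momentum-dependent form of "at most `3⁴` choices";
* §1 the uniqueness theorem for the Fourier transform on `L¹(ℝ × ℝ²)` in the pairing `⟨k,x⟩_-`
  (transport of the tree's `Literature.Analysis.Fourier.ae_eq_zero_of_integral_cexp_mul_eq_zero`,
  Katznelson Ch. VI §1.11), the tool for the remaining case `|P ∖ chg| = 2` (one side changes, the other
  side has two position legs), where the summand vanishes only almost everywhere on the slices of the
  `L¹–L^∞` norm (sequel file).

HYPOTHESES beyond print, as in F7j/F7m: leg-integrability of the pinned sections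
`u ↦ f i (legIns i k π 0 u) s'` (finiteness of the old norm; without it `totalFT` is Bochner junk and the
statement is false as typed); none for the single-leg case.  Theorem-only: no `def`, no named fact
(D-0026), no `instance`, no `notation`; nothing about the Hubbard model is asserted.
-/

noncomputable section

open MeasureTheory Set

namespace Literature.MathematicalPhysics.QuantumLattice.FermiRG

namespace FKTLadders

/-! ### §1 Uniqueness of the Fourier transform on `L¹(ℝ × ℝ²)` in the pairing `⟨k,x⟩_-` -/

/-- **Fourier uniqueness on `L¹(ℝ × ℝ²)` for the pairing `⟨k,x⟩_-` of Definition I.4**: if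
`Ψ ∈ L¹(ℝ × ℝ²)` and `∫ e^{ic⟨p,x⟩_-} Ψ(x) dx = 0` for every `p` (some fixed real `c ≠ 0`), then `Ψ = 0`
almost everywhere.  Transported from the tree's coordinate statement
`Literature.Analysis.Fourier.ae_eq_zero_of_integral_cexp_mul_eq_zero` (Katznelson's uniqueness theorem)
along `(Fin 3 → ℝ) ≃ᵐ ℝ × (Fin 2 → ℝ)`; the pairing is a non-degenerate bilinear form, so its phases
exhaust the characters. [cite: Katznelson2004, Ch. VI §1.11 Corollary] -/
theorem ae_eq_zero_of_forall_integral_mink_eq_zero {Ψ : SpT → ℂ} (hΨ : Integrable Ψ) {c : ℝ}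
    (hc : c ≠ 0)
    (h : ∀ p : SpT, ∫ x : SpT, Complex.exp (Complex.I * (c : ℂ) * (mink p x : ℂ)) * Ψ x = 0) :
    Ψ =ᵐ[volume] 0 := by
  set e : (Fin 3 → ℝ) ≃ᵐ SpT := MeasurableEquiv.piFinSuccAbove (fun _ : Fin 3 => ℝ) 0 with he
  have hmp : MeasurePreserving e (volume : Measure (Fin 3 → ℝ)) (volume : Measure SpT) :=
    volume_preserving_piFinSuccAbove (fun _ : Fin 3 => ℝ) 0
  have he1 : ∀ x : Fin 3 → ℝ, (e x).1 = x 0 := fun x => by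
    simp [he, MeasurableEquiv.piFinSuccAbove_apply]
  have he2 : ∀ (x : Fin 3 → ℝ) (j : Fin 2), (e x).2 j = x j.succ := fun x j => by
    simp [he, MeasurableEquiv.piFinSuccAbove_apply, Fin.tail]
  set F : (Fin 3 → ℝ) → ℂ := fun x => Ψ (e x) with hF
  have hFi : Integrable F := (hmp.integrable_comp_emb e.measurableEmbedding).2 hΨ
  have h0 : ∀ ξ : Fin 3 → ℝ,
      ∫ x : Fin 3 → ℝ, Complex.exp (((-2 * Real.pi * ∑ k, x k * ξ k : ℝ) : ℂ) * Complex.I) * F x = 0 := by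
    intro ξ
    -- the momentum whose `⟨·,·⟩_-`-phase is the character `ξ`
    set p : SpT := (2 * Real.pi * ξ 0 / c, fun j : Fin 2 => -(2 * Real.pi * ξ j.succ / c)) with hp
    have hphase : ∀ x : Fin 3 → ℝ,
        Complex.exp (((-2 * Real.pi * ∑ k, x k * ξ k : ℝ) : ℂ) * Complex.I) =
          Complex.exp (Complex.I * (c : ℂ) * (mink p (e x) : ℂ)) := by
      intro x
      congr 1
      have hm : mink p (e x) = -(p.1 * x 0) + (p.2 0 * x 1 + p.2 1 * x 2) := by
        simp only [mink, he1, he2]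
        rfl
      have hreal : c * mink p (e x) = -2 * Real.pi * ∑ k, x k * ξ k := by
        rw [hm, Fin.sum_univ_three, hp]
        field_simp
        have h1 : (1 : Fin 2).succ = (2 : Fin 3) := rfl
        have h0' : (0 : Fin 2).succ = (1 : Fin 3) := rfl
        simp only [h1, h0']
        ring
      have : ((-2 * Real.pi * ∑ k, x k * ξ k : ℝ) : ℂ) = (c : ℂ) * (mink p (e x) : ℂ) := by
        rw [← hreal]; push_cast; ring
      rw [this]; ring
    calc ∫ x : Fin 3 → ℝ, Complex.exp (((-2 * Real.pi * ∑ k, x k * ξ k : ℝ) : ℂ) * Complex.I) * F x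
        = ∫ x : Fin 3 → ℝ, (fun y : SpT => Complex.exp (Complex.I * (c : ℂ) * (mink p y : ℂ)) * Ψ y)
            (e x) := by
          refine integral_congr_ae (ae_of_all _ fun x => ?_)
          simp only [hF, hphase]
      _ = ∫ y : SpT, Complex.exp (Complex.I * (c : ℂ) * (mink p y : ℂ)) * Ψ y :=
          hmp.integral_comp' (fun y : SpT => Complex.exp (Complex.I * (c : ℂ) * (mink p y : ℂ)) * Ψ y)
      _ = 0 := h p
  have hF0 : F =ᵐ[volume] 0 :=
    Literature.Analysis.Fourier.ae_eq_zero_of_integral_cexp_mul_eq_zero hFi h0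
  -- transfer back along `e`
  have h1 : (fun y : SpT => F (e.symm y)) =ᵐ[volume] fun y => (0 : (Fin 3 → ℝ) → ℂ) (e.symm y) :=
    (hmp.symm e).quasiMeasurePreserving.ae_eq_comp hF0
  refine h1.mono fun y hy => ?_
  simpa [hF] using hy

/-! ### §2 The pinned Fourier transform: name, and re-indexing along equivalent leg predicates -/

/-- The measurable equivalence `piCongrLeft` on a constant family acts by `u ↦ u ∘ ε⁻¹`. [folklore] -/
private theorem piCongrLeft_const_apply {α β : Type*} (ε : α ≃ β) (u : α → SpT) (b : β) :
    (MeasurableEquiv.piCongrLeft (fun _ : β => SpT) ε u) b = u (ε.symm b) := by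
  have h := Equiv.piCongrLeft_apply_apply (P := fun _ : β => SpT) ε u (ε.symm b)
  simp only [Equiv.apply_symm_apply] at h
  simpa [MeasurableEquiv.piCongrLeft] using h

/-- Re-indexing a pinned vector along a predicate `Q` equivalent to "position leg other than `π`":
the `piCongrLeft` transport of `u : {μ // Q μ} → ℝ × ℝ²` is pinned to
`μ ↦ if Q μ then u μ else if μ = π then 0 else k μ`. [cite: FeldmanKnorrerTrubowitz2004Ladders, Definition I.5 (ii) (p.5 L95–108)] -/
theorem legIns_piCongrLeft {i : LegKind} (k : Fin 4 → SpT) {π : Fin 4} (Q : Fin 4 → Prop)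
    [DecidablePred Q] (hQ : ∀ μ, Q μ ↔ (i μ = 1 ∧ μ ≠ π)) (u : {μ : Fin 4 // Q μ} → SpT) :
    legIns i k π 0 (MeasurableEquiv.piCongrLeft (fun _ => SpT) (Equiv.subtypeEquivRight hQ) u) =
      fun μ => if h : Q μ then u ⟨μ, h⟩ else if μ = π then 0 else k μ := by
  funext μ
  by_cases hq : Q μ
  · have h' : i μ = 1 ∧ μ ≠ π := (hQ μ).1 hq
    rw [legIns_apply_of_pos i k π 0 _ h', dif_pos hq, piCongrLeft_const_apply]
    rfl
  · have h' : ¬ (i μ = 1 ∧ μ ≠ π) := fun h'' => hq ((hQ μ).2 h'')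
    simp only [legIns, dif_neg h', dif_neg hq]

/-- **Re-indexing the pinned transform.**  The Fourier transform of `g` PINNED AT THE POSITION LEG `π`
(position legs other than `π` integrated against their phases, leg `π` at the origin, momentum legs frozen
at `k`; the tree's `totalFT` of Definition I.5 (ii) is the case `π = Classical.choose _`, and F7j/F7m's
re-pinning theorems are stated with exactly this integral) equals, over any decidable predicate `Q`
equivalent to "position leg other than `π`", the same integral written over `{μ // Q μ} → ℝ × ℝ²`
(transport along `MeasurableEquiv.piCongrLeft`). [cite: FeldmanKnorrerTrubowitz2004Ladders, Definition I.5 (ii) (p.5 L95–108)] -/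
theorem pinFT_eq_integral_of_iff {i : LegKind} (g : (Fin 4 → SpT) → ℂ) (k : Fin 4 → SpT) {π : Fin 4}
    (Q : Fin 4 → Prop) [DecidablePred Q] (hQ : ∀ μ, Q μ ↔ (i μ = 1 ∧ μ ≠ π)) :
    ∫ u : ({μ : Fin 4 // i μ = 1 ∧ μ ≠ π} → SpT),
        (∏ μ : {μ : Fin 4 // i μ = 1 ∧ μ ≠ π}, legPhase μ.1 (k μ.1) (u μ)) * g (legIns i k π 0 u) =
      ∫ u : ({μ : Fin 4 // Q μ} → SpT), (∏ j : {μ : Fin 4 // Q μ}, legPhase j.1 (k j.1) (u j)) *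
        g (fun μ => if h : Q μ then u ⟨μ, h⟩ else if μ = π then 0 else k μ) := by
  set ε : {μ : Fin 4 // Q μ} ≃ {μ : Fin 4 // i μ = 1 ∧ μ ≠ π} := Equiv.subtypeEquivRight hQ with hε
  set M : ({μ : Fin 4 // Q μ} → SpT) ≃ᵐ ({μ : Fin 4 // i μ = 1 ∧ μ ≠ π} → SpT) :=
    MeasurableEquiv.piCongrLeft (fun _ => SpT) ε with hM
  have hMmp : MeasurePreserving M volume volume := volume_measurePreserving_piCongrLeft (fun _ => SpT) ε
  rw [← hMmp.integral_comp']
  refine integral_congr_ae (ae_of_all _ fun u => ?_)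
  show (∏ μ : {μ : Fin 4 // i μ = 1 ∧ μ ≠ π}, legPhase μ.1 (k μ.1) (M u μ)) * g (legIns i k π 0 (M u)) = _
  congr 1
  · refine Fintype.prod_equiv ε.symm _ _ fun b => ?_
    rw [hM, piCongrLeft_const_apply]
    rfl
  · rw [hM, hε, legIns_piCongrLeft k Q hQ u]

/-- Integrability of a pinned section transports along the re-indexing.
[cite: FeldmanKnorrerTrubowitz2004Ladders, Definition I.5 (ii) (p.5 L95–108)] -/
theorem integrable_reindex_of_integrable_legIns {i : LegKind} (g : (Fin 4 → SpT) → ℂ) (k : Fin 4 → SpT)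
    {π : Fin 4} (Q : Fin 4 → Prop) [DecidablePred Q] (hQ : ∀ μ, Q μ ↔ (i μ = 1 ∧ μ ≠ π))
    (hint : Integrable fun u : {μ : Fin 4 // i μ = 1 ∧ μ ≠ π} → SpT => g (legIns i k π 0 u)) :
    Integrable fun u : {μ : Fin 4 // Q μ} → SpT =>
      g (fun μ => if h : Q μ then u ⟨μ, h⟩ else if μ = π then 0 else k μ) := by
  set ε : {μ : Fin 4 // Q μ} ≃ {μ : Fin 4 // i μ = 1 ∧ μ ≠ π} := Equiv.subtypeEquivRight hQ with hε
  set M : ({μ : Fin 4 // Q μ} → SpT) ≃ᵐ ({μ : Fin 4 // i μ = 1 ∧ μ ≠ π} → SpT) :=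
    MeasurableEquiv.piCongrLeft (fun _ => SpT) ε with hM
  have hMmp : MeasurePreserving M volume volume := volume_measurePreserving_piCongrLeft (fun _ => SpT) ε
  have h := (hMmp.integrable_comp_emb M.measurableEmbedding).2 hint
  refine h.congr (ae_of_all _ fun u => ?_)
  show g (legIns i k π 0 (M u)) = _
  rw [hM, hε, legIns_piCongrLeft k Q hQ u]

/-! ### §3 Momentum completion and the key lemma: the `χ̂`-convolution of a pinned section vanishes -/

/-- Replacing the momentum of leg `π` by the one dictated by conservation,
`K := -(-1)^{b_π} Σ_{μ ≠ π} (-1)^{b_μ} k_μ`, lands on the surface `k₁ - k₂ - k₃ + k₄ = 0`.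
[cite: FeldmanKnorrerTrubowitz2004Ladders, Definition I.5 (ii) (p.5 L95–108)] -/
theorem surface_update_conserved (π : Fin 4) (k : Fin 4 → SpT) :
    let K : SpT := -(((-1 : ℝ) ^ bExp π) • ∑ μ ∈ Finset.univ.erase π, ((-1 : ℝ) ^ bExp μ) • k μ)
    Function.update k π K 0 - Function.update k π K 1 - Function.update k π K 2 +
      Function.update k π K 3 = 0 := by
  classical
  intro K
  rw [← sum_neg_one_pow_bExp_smul, ← Finset.add_sum_erase Finset.univ _ (Finset.mem_univ π),
    Function.update_self]
  have hrest : ∑ μ ∈ Finset.univ.erase π, ((-1 : ℝ) ^ bExp μ) • Function.update k π K μ =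
      ∑ μ ∈ Finset.univ.erase π, ((-1 : ℝ) ^ bExp μ) • k μ :=
    Finset.sum_congr rfl fun μ hμ => by rw [Function.update_of_ne (Finset.mem_erase.1 hμ).1]
  rw [hrest]
  show ((-1 : ℝ) ^ bExp π) • -(((-1 : ℝ) ^ bExp π) • ∑ μ ∈ Finset.univ.erase π, ((-1 : ℝ) ^ bExp μ) • k μ) +
    ∑ μ ∈ Finset.univ.erase π, ((-1 : ℝ) ^ bExp μ) • k μ = 0
  rw [smul_neg, smul_smul, neg_one_pow_bExp_mul_self, one_smul, neg_add_cancel]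

/-- **Key lemma (the support step for a pinned section).**  Let `f` be sectorized at the old scales
`(jl, jr)` and translation invariant, `π` a position leg, `Q ≃ {position legs} ∖ {π}` the legs convolved
with the kernels `χ̂_{s_j}` of the NEW scales (new labels `s`), and `ν ∈ Q` a leg with `s_ν ∈ Σ_new(ν)`
whose new and old extended sectors are disjoint.  If the pinned sections of `f|_i(·, s')` are
integrable (for all momenta agreeing with `k` on the momentum legs), then for every `w`
`∫ (∏_{j ∈ Q} χ̂_{s_j}((-1)^{b_j}(w_j - v_j))) f|_i(v on Q, 0 at π, k on momentum legs; s') dv = 0`.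
Proof: F7j's Fubini computation `integral_prod_chiHat_mul_eq_zero`; its hypothesis — the phase
transform of the pinned section vanishes wherever `∏ χ_{s_j}(q_j) ≠ 0` — holds because `χ_{s_ν}(q_ν) ≠ 0`
puts `q_ν` in the new extended sector (`LadderData.Admissible.chi_support`), hence outside the old one,
and the phase transform is the transform pinned at `π` at the surface point completing `(q, k)`
(`pinFT_eq_integral_of_iff`, `surface_update_conserved`), which vanishes by sectorization at any
pin (F7m's `pinFT_eq_zero_of_not_mem_extSector'`).
[cite: FeldmanKnorrerTrubowitz2004Ladders, Lemma II.16, proof (p.13 L48–53), with Definitions I.6 (p.5 L110–128) and I.18 (p.8 L55–93)] -/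
theorem integral_prod_chiHat_pinned_eq_zero (D : LadderData) (hD : D.Admissible)
    {jl jr jl' jr' : ℕ} {i : LegKind} {f : FourLegFn} (hsec : IsSectorized D.S D.e D.fr jl jr f)
    (htr : IsTranslationInvariant f) (s s' : Fin 4 → Arc) (k : Fin 4 → SpT) {π : Fin 4}
    (hπ : i π = 1) (Q : Fin 4 → Prop) [DecidablePred Q] (hQ : ∀ μ, Q μ ↔ (i μ = 1 ∧ μ ≠ π))
    {ν : Fin 4} (hν : Q ν) (h1ν : 1 ≤ (if ν.val < 2 then jl' else jr'))
    (hsν : s ν ∈ D.Sig (if ν.val < 2 then jl' else jr'))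
    (hdisj : extSector D.S D.e D.fr (if ν.val < 2 then jl' else jr') (s ν) ∩
        extSector D.S D.e D.fr (if ν.val < 2 then jl else jr) (s' ν) = ∅)
    (hint : ∀ (k' : Fin 4 → SpT) (π₀ : Fin 4), i π₀ = 1 → (∀ μ, i μ = 0 → k' μ = k μ) →
      Integrable fun u : {μ : Fin 4 // i μ = 1 ∧ μ ≠ π₀} → SpT => f i (legIns i k' π₀ 0 u) s')
    (w : {μ : Fin 4 // Q μ} → SpT) :
    ∫ v : ({μ : Fin 4 // Q μ} → SpT),
        (∏ j : {μ : Fin 4 // Q μ}, chiHat (D.χ (if j.1.val < 2 then jl' else jr') (s j.1))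
            (((-1 : ℝ) ^ bExp j.1) • (w j - v j))) *
          f i (fun μ => if h : Q μ then v ⟨μ, h⟩ else if μ = π then 0 else k μ) s' = 0 := by
  classical
  -- Step 0: a non-integrable cut-off has `χ̂ ≡ 0`
  by_cases hχ : ∀ j : {μ : Fin 4 // Q μ}, Integrable fun p : SpT =>
      ((D.χ (if j.1.val < 2 then jl' else jr') (s j.1) p : ℝ) : ℂ)
  swap
  · obtain ⟨j, hj⟩ := not_forall.1 hχ
    have h0 : ∀ x, chiHat (D.χ (if j.1.val < 2 then jl' else jr') (s j.1)) x = 0 :=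
      chiHat_eq_zero_of_not_integrable _ hj
    refine integral_eq_zero_of_ae (ae_of_all _ fun v => ?_)
    simp only [Pi.zero_apply]
    rw [Finset.prod_eq_zero (Finset.mem_univ j) (h0 _), zero_mul]
  -- notation
  set χ : {μ : Fin 4 // Q μ} → SpT → ℝ := fun j => D.χ (if j.1.val < 2 then jl' else jr') (s j.1)
    with hχdef
  set σ : {μ : Fin 4 // Q μ} → ℝ := fun j => (-1 : ℝ) ^ bExp j.1 with hσdef
  set G : ({μ : Fin 4 // Q μ} → SpT) → ℂ := fun v =>
    f i (fun μ => if h : Q μ then v ⟨μ, h⟩ else if μ = π then 0 else k μ) s' with hGdef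
  have hG : Integrable G :=
    integrable_reindex_of_integrable_legIns (fun y => f i y s') k Q hQ (hint k π hπ fun _ _ => rfl)
  -- the hypothesis of the Fubini lemma
  have HC : ∀ q : {μ : Fin 4 // Q μ} → SpT, (∏ j, ((χ j) (q j) : ℂ)) *
      ∫ u : {μ : Fin 4 // Q μ} → SpT,
        (∏ j, Complex.exp (Complex.I * ((σ j : ℝ) : ℂ) * (mink (q j) (u j) : ℂ))) * G u = 0 := by
    intro q
    by_cases hq : ∃ j : {μ : Fin 4 // Q μ}, χ j (q j) = 0
    · obtain ⟨j, hj⟩ := hq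
      rw [Finset.prod_eq_zero (Finset.mem_univ j) (by rw [hj]; simp), zero_mul]
    have hq' : ∀ j : {μ : Fin 4 // Q μ}, χ j (q j) ≠ 0 := fun j hj => hq ⟨j, hj⟩
    -- the momentum of leg `ν` lies in the NEW extended sector, hence not in the old one
    have hνnew : q ⟨ν, hν⟩ ∈ extSector D.S D.e D.fr (if ν.val < 2 then jl' else jr') (s ν) :=
      hD.chi_support _ h1ν _ hsν (hq' ⟨ν, hν⟩)
    have hνold : q ⟨ν, hν⟩ ∉ extSector D.S D.e D.fr (if ν.val < 2 then jl else jr) (s' ν) := by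
      intro hB
      have : q ⟨ν, hν⟩ ∈ extSector D.S D.e D.fr (if ν.val < 2 then jl' else jr') (s ν) ∩
          extSector D.S D.e D.fr (if ν.val < 2 then jl else jr) (s' ν) := ⟨hνnew, hB⟩
      rw [hdisj] at this
      exact this
    -- complete `(q, k)` to a configuration on the conservation surface
    set k'' : Fin 4 → SpT := fun μ => if h : Q μ then q ⟨μ, h⟩ else k μ with hk''def
    set k' : Fin 4 → SpT := Function.update k'' π
      (-(((-1 : ℝ) ^ bExp π) • ∑ μ ∈ Finset.univ.erase π, ((-1 : ℝ) ^ bExp μ) • k'' μ)) with hk'def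
    have hk' : k' 0 - k' 1 - k' 2 + k' 3 = 0 := surface_update_conserved π k''
    have hk'q : ∀ j : {μ : Fin 4 // Q μ}, k' j.1 = q j := by
      intro j
      have hjπ : j.1 ≠ π := ((hQ j.1).1 j.2).2
      rw [hk'def, Function.update_of_ne hjπ, hk''def]
      simp only [dif_pos j.2]
    have hk'mom : ∀ μ, i μ = 0 → k' μ = k μ := by
      intro μ hμ
      have hμπ : μ ≠ π := fun h => by rw [h] at hμ; omega
      have hμQ : ¬ Q μ := fun h => by have := ((hQ μ).1 h).1; omega
      rw [hk'def, Function.update_of_ne hμπ, hk''def]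
      simp only [dif_neg hμQ]
    have hνi : i ν = 1 := ((hQ ν).1 hν).1
    have hk'ν : k' ν ∉ extSector D.S D.e D.fr (if ν.val < 2 then jl else jr) (s' ν) := by
      rw [hk'q ⟨ν, hν⟩]; exact hνold
    have hzero : ∫ u : ({μ : Fin 4 // Q μ} → SpT), (∏ j : {μ : Fin 4 // Q μ}, legPhase j.1 (k' j.1) (u j)) *
        f i (fun μ => if h : Q μ then u ⟨μ, h⟩ else if μ = π then 0 else k' μ) s' = 0 :=
      (pinFT_eq_integral_of_iff (fun y => f i y s') k' Q hQ).symm.trans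
        (pinFT_eq_zero_of_not_mem_extSector' D.S D.e D.fr hsec htr s' k' hk' hπ
          (fun π₀ h₀ => hint k' π₀ h₀ hk'mom) hνi hk'ν)
    have hG' : ∀ u : {μ : Fin 4 // Q μ} → SpT,
        (∏ j : {μ : Fin 4 // Q μ}, Complex.exp (Complex.I * ((σ j : ℝ) : ℂ) * (mink (q j) (u j) : ℂ))) *
            G u =
          (∏ j : {μ : Fin 4 // Q μ}, legPhase j.1 (k' j.1) (u j)) *
            f i (fun μ => if h : Q μ then u ⟨μ, h⟩ else if μ = π then 0 else k' μ) s' := by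
      intro u
      rw [hGdef]
      beta_reduce
      congr 1
      · refine Finset.prod_congr rfl fun j _ => ?_
        rw [legPhase, hk'q j, hσdef]
        push_cast
        ring_nf
      · congr 1
        funext μ
        by_cases hμ : Q μ
        · rw [dif_pos hμ, dif_pos hμ]
        · rw [dif_neg hμ, dif_neg hμ]
          by_cases hμπ : μ = π
          · rw [if_pos hμπ, if_pos hμπ]
          · have hμ0 : i μ = 0 := by
              have : ¬ (i μ = 1 ∧ μ ≠ π) := fun h => hμ ((hQ μ).2 h)
              omega
            rw [if_neg hμπ, if_neg hμπ, hk'mom μ hμ0]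
    simp_rw [hG']
    rw [hzero, mul_zero]
  exact integral_prod_chiHat_mul_eq_zero χ σ G hG hχ HC w

/-! ### §4 The support step: one non-changing position leg; a single position leg -/

/-- `volume` on a finite power of `ℝ × ℝ²` is translation invariant (right). [folklore] -/
private theorem isAddRightInvariant_volume_pi_SpT' {κ : Type*} [Fintype κ] :
    (volume : Measure (κ → SpT)).IsAddRightInvariant := by
  haveI : (volume : Measure SpT).IsAddHaarMeasure := by
    rw [Measure.volume_eq_prod]; infer_instance
  show (Measure.pi fun _ : κ => (volume : Measure SpT)).IsAddRightInvariant
  infer_instance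

/-- The momentum-leg phase factor of Definition I.4 (ii) only reads the momentum legs.
[cite: FeldmanKnorrerTrubowitz2004Ladders, Definition I.4 (ii) (p.5 L48–64)] -/
theorem prod_momPhase_congr (i : LegKind) (x y : Fin 4 → SpT) (t : SpT)
    (h : ∀ μ, i μ = 0 → x μ = y μ) :
    (∏ μ : Fin 4, if i μ = 0 then legPhase μ (x μ) t else 1) =
      ∏ μ : Fin 4, if i μ = 0 then legPhase μ (y μ) t else 1 :=
  Finset.prod_congr rfl fun μ _ => by
    by_cases hμ : i μ = 0
    · rw [if_pos hμ, if_pos hμ, h μ hμ]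
    · rw [if_neg hμ, if_neg hμ]

/-- **Support step, case `n₀ = 1`: exactly one position leg `π` does not change scale.**  For admissible
ladder data, `f` sectorized at `(jl, jr)` and translation invariant with integrable pinned sections,
convolved legs `chg ≃ {position legs} ∖ {π}` carrying new labels at the new scales `(jl', jr')`, and a
convolved leg `ν` with `s_ν ∈ Σ_new(ν)` whose new and old extended sectors are disjoint, the `s'`-summand
of the resectorisation vanishes for EVERY `y`:
`∫ (∏_{μ ∈ chg} χ̂_{s_μ}((-1)^{b_μ}(y_μ - x'_μ))) f|_i(x' on chg, y elsewhere; s') dx' = 0`.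
(Translate by `y_π`: the integrand is a momentum-leg phase times the `χ̂`-convolution of the section
pinned at `π`, and `integral_prod_chiHat_pinned_eq_zero` applies.)
[cite: FeldmanKnorrerTrubowitz2004Ladders, Lemma II.16, proof (p.13 L48–53), with Definition I.18 (p.8 L55–93)] -/
theorem integral_resect_eq_zero_of_disjoint_pinFree (D : LadderData) (hD : D.Admissible)
    {jl jr jl' jr' : ℕ} {i : LegKind} {f : FourLegFn} (hsec : IsSectorized D.S D.e D.fr jl jr f)
    (htr : IsTranslationInvariant f) (s s' : Fin 4 → Arc) (chg : Fin 4 → Prop) [DecidablePred chg]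
    {π : Fin 4} (hπ : i π = 1) (hchg : ∀ μ, chg μ ↔ (i μ = 1 ∧ μ ≠ π))
    {ν : Fin 4} (hν : chg ν) (h1ν : 1 ≤ (if ν.val < 2 then jl' else jr'))
    (hsν : s ν ∈ D.Sig (if ν.val < 2 then jl' else jr'))
    (hdisj : extSector D.S D.e D.fr (if ν.val < 2 then jl' else jr') (s ν) ∩
        extSector D.S D.e D.fr (if ν.val < 2 then jl else jr) (s' ν) = ∅)
    (hint : ∀ (k : Fin 4 → SpT) (π₀ : Fin 4), i π₀ = 1 →
      Integrable fun u : {μ : Fin 4 // i μ = 1 ∧ μ ≠ π₀} → SpT => f i (legIns i k π₀ 0 u) s')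
    (y : Fin 4 → SpT) :
    ∫ x' : ({μ : Fin 4 // chg μ} → SpT),
        (∏ μ : {μ : Fin 4 // chg μ},
            chiHat (D.χ (if μ.1.val < 2 then jl' else jr') (s μ.1))
              (((-1 : ℝ) ^ bExp μ.1) • (y μ.1 - x' μ))) *
          f i (fun μ => if h : chg μ then x' ⟨μ, h⟩ else y μ) s' = 0 := by
  classical
  haveI := isAddRightInvariant_volume_pi_SpT' (κ := {μ : Fin 4 // chg μ})
  set c : SpT := y π with hc
  -- the pinned vector (momenta read from `y`) and the momentum-leg phase of the translation by `c`
  set fill : ({μ : Fin 4 // chg μ} → SpT) → (Fin 4 → SpT) := fun v μ =>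
    if h : chg μ then v ⟨μ, h⟩ else if μ = π then 0 else y μ with hfill
  set Θ : ℂ := ∏ μ : Fin 4, if i μ = 0 then legPhase μ (y μ) c else 1 with hΘ
  have hV : ∀ x' : {μ : Fin 4 // chg μ} → SpT,
      (fun μ => if h : chg μ then x' ⟨μ, h⟩ else y μ) =
        translate i c (fill (x' - fun _ => c)) := by
    intro x'
    funext μ
    by_cases hμ : chg μ
    · have h1 : i μ = 1 := ((hchg μ).1 hμ).1
      have h0 : ¬ i μ = 0 := by omega
      simp only [dif_pos hμ, translate, if_neg h0, hfill, Pi.sub_apply, sub_add_cancel]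
    · rw [dif_neg hμ]
      by_cases hμπ : μ = π
      · subst hμπ
        have h0 : ¬ i μ = 0 := by omega
        simp only [translate, if_neg h0, hfill, dif_neg hμ, if_true, zero_add, hc]
      · have h0 : i μ = 0 := by
          have : ¬ (i μ = 1 ∧ μ ≠ π) := fun h => hμ ((hchg μ).2 h)
          omega
        simp only [translate, if_pos h0, hfill, dif_neg hμ, if_neg hμπ]
  have hf : ∀ x' : {μ : Fin 4 // chg μ} → SpT,
      f i (fun μ => if h : chg μ then x' ⟨μ, h⟩ else y μ) s' = Θ * f i (fill (x' - fun _ => c)) s' := by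
    intro x'
    rw [hV x', htr.1 i c _ s', hΘ]
    congr 1
    refine prod_momPhase_congr i _ y c fun μ hμ => ?_
    have hμc : ¬ chg μ := fun h => by have := ((hchg μ).1 h).1; omega
    have hμπ : μ ≠ π := fun h => by rw [h] at hμ; omega
    simp only [hfill, dif_neg hμc, if_neg hμπ]
  -- the integrand is a translate of `H`
  set H : ({μ : Fin 4 // chg μ} → SpT) → ℂ := fun v =>
    (∏ μ : {μ : Fin 4 // chg μ},
        chiHat (D.χ (if μ.1.val < 2 then jl' else jr') (s μ.1))
          (((-1 : ℝ) ^ bExp μ.1) • ((y μ.1 - c) - v μ))) * f i (fill v) s' with hH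
  have hintegrand : ∀ x' : {μ : Fin 4 // chg μ} → SpT,
      (∏ μ : {μ : Fin 4 // chg μ},
          chiHat (D.χ (if μ.1.val < 2 then jl' else jr') (s μ.1))
            (((-1 : ℝ) ^ bExp μ.1) • (y μ.1 - x' μ))) *
        f i (fun μ => if h : chg μ then x' ⟨μ, h⟩ else y μ) s' = Θ * H (x' - fun _ => c) := by
    intro x'
    rw [hf x', hH]
    simp only [Pi.sub_apply, sub_sub_sub_cancel_right]
    ring
  simp_rw [hintegrand]
  rw [integral_const_mul, integral_sub_right_eq_self H (fun _ : {μ : Fin 4 // chg μ} => c)]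
  have hH0 : ∫ v, H v = 0 := by
    rw [hH]
    exact integral_prod_chiHat_pinned_eq_zero D hD hsec htr s s' y hπ chg hchg hν h1ν hsν hdisj
      (fun k' π₀ h₀ _ => hint k' π₀ h₀) (fun j => y j.1 - c)
  rw [hH0, mul_zero]

/-- **A component with a single position leg: sectorization is a pointwise support condition.**  If
`ν` is the only position leg of the leg-kind vector `i`, `f` is sectorized at `(jl, jr)` and translation
invariant, and `k` is a momentum configuration on the conservation surface agreeing with the argument
`y` on the momentum legs with `k_ν ∉ s̃'_ν`, then `f|_i(y; s') = 0`: the total Fourier transform of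
Definition I.5 (ii) has no integration variable here (it is `f` pinned at `ν`, for any pin by F7m's
`pinFT_eq_zero_of_not_mem_extSector'`), and translation invariance moves the position of leg `ν` to the
origin at the cost of a phase.  No integrability hypothesis: the slices are over an empty index type.
[cite: FeldmanKnorrerTrubowitz2004Ladders, Definition I.6 (p.5 L110–128) with Definition I.5 (ii) (p.5 L95–108) and Definition I.4 (ii) (p.5 L48–64)] -/
theorem apply_eq_zero_of_not_mem_extSector_single (S : ScaleData) (e : (Fin 2 → ℝ) → ℝ)
    (fr : FermiFrame) {jl jr : ℕ} {i : LegKind} {f : FourLegFn} (hsec : IsSectorized S e fr jl jr f)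
    (htr : IsTranslationInvariant f) (s' : Fin 4 → Arc) {ν : Fin 4} (hν : i ν = 1)
    (huniq : ∀ μ, i μ = 1 → μ = ν) (y k : Fin 4 → SpT) (hk : k 0 - k 1 - k 2 + k 3 = 0)
    (hky : ∀ μ, ¬ i μ = 1 → k μ = y μ)
    (hkν : k ν ∉ extSector S e fr (if ν.val < 2 then jl else jr) (s' ν)) :
    f i y s' = 0 := by
  classical
  have hemp : ∀ j : {μ : Fin 4 // i μ = 1 ∧ μ ≠ ν}, False := fun j => j.2.2 (huniq j.1 j.2.1)
  haveI : IsEmpty {μ : Fin 4 // i μ = 1 ∧ μ ≠ ν} := ⟨hemp⟩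
  let u₀ : {μ : Fin 4 // i μ = 1 ∧ μ ≠ ν} → SpT := fun j => (hemp j).elim
  have huniv : (volume : Measure ({μ : Fin 4 // i μ = 1 ∧ μ ≠ ν} → SpT)) Set.univ = 1 := by
    rw [volume_pi, Measure.pi_univ]
    simp
  haveI : IsFiniteMeasure (volume : Measure ({μ : Fin 4 // i μ = 1 ∧ μ ≠ ν} → SpT)) :=
    ⟨by rw [huniv]; exact ENNReal.one_lt_top⟩
  -- every pinned slice is over the empty index type, hence a constant: integrable
  have hint : ∀ π₀ : Fin 4, i π₀ = 1 →
      Integrable fun u : {μ : Fin 4 // i μ = 1 ∧ μ ≠ π₀} → SpT => f i (legIns i k π₀ 0 u) s' := by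
    intro π₀ hπ₀
    obtain rfl : π₀ = ν := huniq π₀ hπ₀
    have hconst : (fun u : {μ : Fin 4 // i μ = 1 ∧ μ ≠ π₀} → SpT => f i (legIns i k π₀ 0 u) s') =
        fun _ => f i (legIns i k π₀ 0 u₀) s' :=
      funext fun u => by rw [show u = u₀ from funext fun j => (hemp j).elim]
    rw [hconst]
    exact integrable_const _
  have hzero := pinFT_eq_zero_of_not_mem_extSector' S e fr hsec htr s' k hk hν hint hν hkν
  have hconst : (fun u : {μ : Fin 4 // i μ = 1 ∧ μ ≠ ν} → SpT =>
      (∏ μ : {μ : Fin 4 // i μ = 1 ∧ μ ≠ ν}, legPhase μ.1 (k μ.1) (u μ)) * f i (legIns i k ν 0 u) s') =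
      fun _ => f i (legIns i k ν 0 u₀) s' := by
    funext u
    rw [show u = u₀ from funext fun j => (hemp j).elim, Finset.univ_eq_empty, Finset.prod_empty,
      one_mul]
  rw [hconst, integral_const, Measure.real, huniv] at hzero
  simp only [ENNReal.toReal_one, one_smul] at hzero
  -- move the position of leg `ν` to the origin
  have hyT : y = translate i (y ν) (legIns i k ν 0 u₀) := by
    funext μ
    by_cases hμν : μ = ν
    · subst hμν
      have h0 : ¬ i μ = 0 := by omega
      simp only [translate, if_neg h0, legIns_apply_self, zero_add]
    · have h1' : ¬ i μ = 1 := fun h => hμν (huniq μ h)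
      have h0 : i μ = 0 := by omega
      have h1 : legIns i k ν 0 u₀ μ = y μ := by
        rw [legIns_apply_of_mom i k ν 0 u₀ h1' hμν, hky μ h1']
      simp only [translate, if_pos h0, h1]
  rw [hyT, htr.1 i (y ν) _ s', hzero, mul_zero]

variable (D : LadderData)

/-- **Support step for a component with a single position leg, at the level of `resectTerm`.**  If
`ν` is the only position leg, the `s'`-summand of the resectorisation of `f` (sectorized at `(jl, jr)`,
translation invariant) vanishes at every `y` whose conserved momentum of leg `ν` — any surface
configuration `k` agreeing with `y` on the momentum legs — lies outside `s̃'_ν`, WHATEVER the new labels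
`s`: the integrand only evaluates `f|_i(·; s')` at arguments with the same momentum legs as `y`.  So for
this component at most the `≤ 2` old sectors containing the conserved momentum survive
(`card_filter_mem_extSector_le_two`, F7i). [cite: FeldmanKnorrerTrubowitz2004Ladders, Lemma II.16, proof (p.13 L48–53), with Definition I.6 (p.5 L110–128)] -/
theorem resectTerm_eq_zero_of_not_mem_extSector_single {jl jr jl' jr' : ℕ} {i : LegKind}
    {f : FourLegFn} (hsec : IsSectorized D.S D.e D.fr jl jr f) (htr : IsTranslationInvariant f)
    (s s' : Fin 4 → Arc) {ν : Fin 4} (hν : i ν = 1) (huniq : ∀ μ, i μ = 1 → μ = ν)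
    (y k : Fin 4 → SpT) (hk : k 0 - k 1 - k 2 + k 3 = 0) (hky : ∀ μ, ¬ i μ = 1 → k μ = y μ)
    (hkν : k ν ∉ extSector D.S D.e D.fr (if ν.val < 2 then jl else jr) (s' ν)) :
    resectTerm D jl jr jl' jr' f i s s' y = 0 := by
  unfold resectTerm
  refine integral_eq_zero_of_ae (ae_of_all _ fun x' => ?_)
  show _ = (0 : ℂ)
  have hval : f i (fun μ => if h : i μ = 1 ∧ ((μ.val < 2 ∧ jl' ≠ jl) ∨ (2 ≤ μ.val ∧ jr' ≠ jr))
      then x' ⟨μ, h⟩ else y μ) s' = 0 := by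
    refine apply_eq_zero_of_not_mem_extSector_single D.S D.e D.fr hsec htr s' hν huniq _ k hk
      (fun μ hμ => ?_) hkν
    have : ¬ (i μ = 1 ∧ ((μ.val < 2 ∧ jl' ≠ jl) ∨ (2 ≤ μ.val ∧ jr' ≠ jr))) := fun h => hμ h.1
    simp only [dif_neg this, hky μ hμ]
  simp only [hval, mul_zero]

end FKTLadders



end Literature.MathematicalPhysics.QuantumLattice.FermiRG
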